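import Mathlib
import HarnessLib
import Literature.Computability.ImplicitComplexity.ObsessionalCliques

/-!
# The word→boolean interface of the untyped relational model (`CliqueDecides`)

Complement to `Literature.Computability.ImplicitComplexity.ObsessionalCliques` (the space `D` of
points `URel.Point`, duality, the `t`-action of `(ℕ*, ·)`, `URel.IsObsessional`,
`URel.ObsessionalFrom` of Laurent–Tortora de Falco, LICS 2006 = LTdF), for the route
PneNP/LightLogic (cruxes `AbsoluteObsessionality`, `OracleRefusal`): the data types at which a
clique `c ⊆ D` is asked to DECIDE a language `L ⊆ {0,1}*`.

LTdF §2.1: "binary integers are represented by proofs of `W = ∀X ?(B ⊗ X ⊗ X⊥) ⅋ X⊥ ⅋ X` where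
`B = ∀X X⊥ ⅋ X⊥ ⅋ (X ⊗ X)`, and predicates over integers are represented by proofs of
`⊢ W⊥, …, W⊥, B` which do not contain any `?m`-rule (for the application of a predicate to an
argument in `W`, we first have to duplicate it the appropriate number of times)"; App. B: the
predicate net with `k` conclusions `W⊥` is cut with `k` copies of the word net.  Def. 12: the
result of an experiment of a net with conclusions labelled `x₁, …, xₙ` is the LEFT-nested point
`(⋯((x₁ ⅋ x₂) ⅋ x₃)⋯) ⅋ xₙ`, and `⟦R⟧` is the set of results.

* `URel.boolClique b` — `⟦tt⟧` / `⟦ff⟧`: the interpretations of the nets of the two cut-free proofs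
  of `B` (`B` is Lafont's multiplicative Boolean type `(α ⊗ α) ⊸ (α ⊗ α)`: identity and twist);
* `URel.wordClique w` — `⟦w̄⟧`: the interpretation of the net of the canonical cut-free proof of
  `W` coding the word `w` (a list of Booleans, `W` being `!(B ⊸ α ⊸ α) ⊸ α ⊸ α`);
* `URel.Point.predPoint xs y` — the result point of a predicate net `⊢ W⊥, …, W⊥, B` (`k = |xs|`
  input labels, output label `y`), nested as in Def. 12; `URel.feed k c A` — the interpretation of
  the predicate net `c` cut against `k` copies of an argument net `A` (cut clause of Def. 12);
  `URel.compose c d` — composition of cliques of types `A⊥ ⅋ B` and `B⊥ ⅋ C` along a cut;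
  obsessional cliques compose (`IsObsessional.feed`, `IsObsessional.compose`: the untyped shadow
  of LTdF Prop. 1, `OREL` is a category);
* `URel.CliqueDecides k c L` — for every word `w`, `feed k c ⟦w̄⟧ = ⟦tt⟧` if `w ∈ L` and `= ⟦ff⟧`
  if `w ∉ L` (total and consistent); since `⟦tt⟧ ≠ ⟦ff⟧` (`boolClique_true_ne_false`; the two
  cliques do meet — `REL` is not complete) the decided language is unique (`CliqueDecides.unique`).
* Point-level API of `URel.Point` used here: `dual`/`act` on the constructors
  (`Point.dual_tensor`, `Point.dual_whyNot`, `Point.act_par`, …) and injectivity of `⊗`, `⅋`.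

## Conventions of this file (NOT printed in LTdF)

LTdF write `B` and `W` flat; nets have binary `⊗`/`⅋` nodes, so a bracketing must be fixed to get
actual subsets of `D`.  We take the structural translation of the intuitionistic types
(`(A ⊸ C)° = A°⊥ ⅋ C°`, `(A ⊗ C)° = A° ⊗ C°`): `B = (X⊥ ⅋ X⊥) ⅋ (X ⊗ X)` from
`(α ⊗ α) ⊸ (α ⊗ α)`, and `W = ?(B ⊗ (X ⊗ X⊥)) ⅋ (X⊥ ⅋ X)` from `!(B ⊸ α ⊸ α) ⊸ (α ⊸ α)`.
`tt` is the identity `λ⟨u,v⟩.⟨u,v⟩` and `ff` the twist `λ⟨u,v⟩.⟨v,u⟩` (exchanging them replaces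
`CliqueDecides k c L` by `CliqueDecides k c Lᶜ`); the word `b₀ … bₙ₋₁` is the proof
`λc z. c b₀ (c b₁ (… (c bₙ₋₁ z)))` (head applied outermost, as `STA.encWord`; reading words
backwards replaces `L` by its reversal); its `n` derelicted copies of `c` are contracted, a bundle
of `n` branches of length 1 — a uSLL net of depth `0` with one exponential tree of size `< 2n + 1`,
as in LTdF App. B.  The conclusions of a predicate net are ordered inputs first, output last, as
printed (`⊢ W⊥, …, W⊥, B`).

The tree's syntax for soft linear logic is the term calculus `STA` (file `SoftTypeAssignment`,
`SoftRepresentsAtLevel`), whose data types are the affine Booleans `∀α. α ⊸ α ⊸ α` and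
`S_m = ∀α.!ᵐ(B ⊸ α ⊸ α) ⊸ α ⊸ α`; relating `SoftRepresentsAtLevel t L` to `CliqueDecides k ⟦·⟧ L`
(adequacy, LTdF Thm 3) needs the interpretation of programs in `D` (experiments of nets, or a
relational semantics of `STA` derivations) and the coercions between these data types —
deliberately NOT in this file, like Prop. 8 and Thm 4 of LTdF.

## References

* O. Laurent, L. Tortora de Falco, *Obsessional cliques: a semantic characterization of bounded
  time complexity*, LICS 2006, 179–188, doi:10.1109/lics.2006.37 — §2.1 (`B`, `W`, predicates
  `⊢ W⊥, …, W⊥, B`), Def. 2 (composition in `ℕREL`), Prop. 1 (`OREL`), Def. 12 (experiments: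
  axiom, cut, `⊗/⅋`, `?d/?w/?c` clauses; left-nested results), Remark 2, App. B.
* Y. Lafont, *Soft linear logic and polynomial time*, TCS 318 (2004), §5 and Conclusion
  (multiplicative Booleans `∀α. α² ⊸ α²`).
-/

namespace Literature.Computability.ImplicitComplexity.URel

namespace Point

/-! ### Point-level computation rules (complements to `ObsessionalCliques`) -/

/-- `1̄ = ⊥` in `D`. [cite: LaurentTortoraDeFalco2006, §5.1] -/
@[simp] theorem dual_one : dual Point.one = Point.bot := rfl

/-- `⊥̄ = 1` in `D`. [cite: LaurentTortoraDeFalco2006, §5.1] -/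
@[simp] theorem dual_bot : dual Point.bot = Point.one := rfl

/-- `(x ⊗ y)‾ = x̄ ⅋ ȳ` in `D`. [cite: LaurentTortoraDeFalco2006, §5.1] -/
@[simp] theorem dual_tensor (p q : Point) : dual (tensor p q) = par (dual p) (dual q) := by
  induction p using Point.ind with
  | h x => induction q using Point.ind with
    | h y => rfl

/-- `(x ⅋ y)‾ = x̄ ⊗ ȳ` in `D`. [cite: LaurentTortoraDeFalco2006, §5.1] -/
@[simp] theorem dual_par (p q : Point) : dual (par p q) = tensor (dual p) (dual q) := by
  induction p using Point.ind with
  | h x => induction q using Point.ind with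
    | h y => rfl

/-- The entries of the canonical presentation of `!m`/`?m`, dualised and read back in `D`, are
`m.map dual`. [cite: LaurentTortoraDeFalco2006, §5.1] -/
theorem coe_map_mk_dualList_toList_out (m : Multiset Point) :
    (((PrePoint.dualList (m.map Quotient.out).toList).map mk : List Point) : Multiset Point) =
      m.map dual := by
  rw [PrePoint.dualList_eq_map, List.map_map]
  have : mk ∘ PrePoint.dual = dual ∘ mk := funext fun x => (dual_mk x).symm
  rw [this, ← List.map_map, ← Multiset.map_coe, coe_map_mk_toList_out]

/-- `(!μ)‾ = ?μ̄` in `D`. [cite: LaurentTortoraDeFalco2006, §5.1] -/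
@[simp] theorem dual_ofCourse (m : Multiset Point) : dual (ofCourse m) = whyNot (m.map dual) := by
  show mk (PrePoint.whyNot _) = _
  rw [mk_whyNot, coe_map_mk_dualList_toList_out]

/-- `(?μ)‾ = !μ̄` in `D`. [cite: LaurentTortoraDeFalco2006, §5.1] -/
@[simp] theorem dual_whyNot (m : Multiset Point) : dual (whyNot m) = ofCourse (m.map dual) := by
  show mk (PrePoint.ofCourse _) = _
  rw [mk_ofCourse, coe_map_mk_dualList_toList_out]

/-- `⊗` is injective on `D`. [cite: LaurentTortoraDeFalco2006, §5.1] -/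
@[simp] theorem tensor_inj {p q p' q' : Point} : tensor p q = tensor p' q' ↔ p = p' ∧ q = q' := by
  induction p using Point.ind with
  | h x => induction q using Point.ind with
    | h y => induction p' using Point.ind with
      | h x' => induction q' using Point.ind with
        | h y' => simp [mk_eq_mk, PrePoint.code, Nat.pair_eq_pair]

/-- `⅋` is injective on `D`. [cite: LaurentTortoraDeFalco2006, §5.1] -/
@[simp] theorem par_inj {p q p' q' : Point} : par p q = par p' q' ↔ p = p' ∧ q = q' := by
  induction p using Point.ind with
  | h x => induction q using Point.ind with
    | h y => induction p' using Point.ind with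
      | h x' => induction q' using Point.ind with
        | h y' => simp [mk_eq_mk, PrePoint.code, Nat.pair_eq_pair]

/-- `⊥ ≠ 1` in `D`. [cite: LaurentTortoraDeFalco2006, §5.1] -/
theorem bot_ne_one : Point.bot ≠ Point.one := fun h => one_ne_bot h.symm

/-- `(1)ₜ⁽ᵏ⁾ = 1`. [cite: LaurentTortoraDeFalco2006, Def. 13] -/
@[simp] theorem act_one' (t k : ℕ) : act t k Point.one = Point.one := rfl

/-- `(⊥)ₜ⁽ᵏ⁾ = ⊥`. [cite: LaurentTortoraDeFalco2006, Def. 13] -/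
@[simp] theorem act_bot (t k : ℕ) : act t k Point.bot = Point.bot := rfl

/-- `(x ⊗ y)ₜ⁽ᵏ⁾ = (x)ₜ⁽ᵏ⁾ ⊗ (y)ₜ⁽ᵏ⁾`. [cite: LaurentTortoraDeFalco2006, Def. 13] -/
@[simp] theorem act_tensor (t k : ℕ) (p q : Point) :
    act t k (tensor p q) = tensor (act t k p) (act t k q) := by
  induction p using Point.ind with
  | h x => induction q using Point.ind with
    | h y => rfl

/-- `(x ⅋ y)ₜ⁽ᵏ⁾ = (x)ₜ⁽ᵏ⁾ ⅋ (y)ₜ⁽ᵏ⁾`. [cite: LaurentTortoraDeFalco2006, Def. 13] -/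
@[simp] theorem act_par (t k : ℕ) (p q : Point) : act t k (par p q) = par (act t k p) (act t k q) := by
  induction p using Point.ind with
  | h x => induction q using Point.ind with
    | h y => rfl

/-! ### Results of experiments of the data-type nets and of predicate nets -/

/-- The result of the experiment of the net of the cut-free proof **identity** of
`B = (X⊥ ⅋ X⊥) ⅋ (X ⊗ X)` (`λ⟨u,v⟩.⟨u,v⟩ : (α ⊗ α) ⊸ (α ⊗ α)`, our `tt`) whose two axiom links
carry `a` on the first `X⊥` (input `u`) and `b` on the second (input `v`): `(a ⅋ b) ⅋ (ā ⊗ b̄)`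
(axiom clause of Def. 12: the two conclusions of an axiom carry dual labels; bracketing of `B` =
convention of this file). [cite: LaurentTortoraDeFalco2006, Def. 12] -/
def ttPoint (a b : Point) : Point :=
  par (par a b) (tensor (dual a) (dual b))

/-- The result of the experiment of the net of the cut-free proof **twist** of `B`
(`λ⟨u,v⟩.⟨v,u⟩`, our `ff`) with axiom labels `a`, `b` on the two `X⊥`: `(a ⅋ b) ⅋ (b̄ ⊗ ā)`.
[cite: LaurentTortoraDeFalco2006, Def. 12] -/
def ffPoint (a b : Point) : Point :=
  par (par a b) (tensor (dual b) (dual a))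

/-- The result of an experiment of the net `w̄` of a word of length `n` from the results
`β i ∈ ⟦wᵢ⟧` of its Boolean sub-nets and the labels `p 0, …, p n` of the chain of `X`-axioms:
`?[β₀ ⊗ (p̄₁ ⊗ p₀), …, βₙ₋₁ ⊗ (p̄ₙ ⊗ pₙ₋₁)] ⅋ (pₙ ⅋ p̄₀)` — the `i`-th derelicted copy of the step
function `c : B ⊸ X ⊸ X` (dual type `B ⊗ (X ⊗ X⊥)`) receives the Boolean `wᵢ`, the output of copy
`i+1` as argument (label `p̄ᵢ₊₁` on its `X`-port) and returns on its `X⊥`-port (label `pᵢ`);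
`pₙ` labels the input `z` and `p̄₀` the final output; the `?d` premisses are collected by the
`?c`-tree into one multiset (`n = 0`: `?[] ⅋ (p₀ ⅋ p̄₀)`, the net of `λc z. z` with a `?w`-node)
(clauses `ax, ⊗, ⅋, ?d, ?c, ?w` of Def. 12; bracketing of `W` = convention of this file).
[cite: LaurentTortoraDeFalco2006, Def. 12] -/
noncomputable def wordPoint (n : ℕ) (β : Fin n → Point) (p : Fin (n + 1) → Point) : Point :=
  par (whyNot (List.ofFn fun i : Fin n => tensor (β i) (tensor (dual (p i.succ)) (p i.castSucc)) :
      List Point))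
    (par (p (Fin.last n)) (dual (p 0)))

/-- The result of an experiment of a PREDICATE net `⊢ W⊥, …, W⊥, B` (conclusions in the printed
order) whose `k` input conclusions carry the labels `xs = [x₁, …, x_k]` and whose output carries
`y`: the left-nested point `(⋯((x₁ ⅋ x₂) ⅋ x₃)⋯ ⅋ x_k) ⅋ y` of Def. 12 (`k = 0`: `y`; `k = 1`:
`x₁ ⅋ y`). [cite: LaurentTortoraDeFalco2006, Def. 12] -/
def predPoint : List Point → Point → Point
  | [], y => y
  | x :: xs, y => par (xs.foldl par x) y

/-- `predPoint [] y = y`. [cite: LaurentTortoraDeFalco2006, Def. 12] -/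
@[simp] theorem predPoint_nil (y : Point) : predPoint [] y = y := rfl

/-- `predPoint [x] y = x ⅋ y`. [cite: LaurentTortoraDeFalco2006, Def. 12] -/
@[simp] theorem predPoint_singleton (x y : Point) : predPoint [x] y = par x y := rfl

/-- `predPoint (x :: xs) y = (foldl ⅋ x xs) ⅋ y`. [cite: LaurentTortoraDeFalco2006, Def. 12] -/
theorem predPoint_cons (x : Point) (xs : List Point) (y : Point) :
    predPoint (x :: xs) y = par (xs.foldl par x) y := rfl

/-- The action is homomorphic on left-nested `⅋`s. [cite: LaurentTortoraDeFalco2006, Def. 13] -/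
theorem act_foldl_par (t k : ℕ) (x : Point) (xs : List Point) :
    act t k (xs.foldl par x) = (xs.map (act t k)).foldl par (act t k x) := by
  induction xs generalizing x with
  | nil => rfl
  | cons z xs ih => rw [List.foldl_cons, List.map_cons, List.foldl_cons, ih, act_par]

/-- The action is homomorphic on results of predicate nets. [cite: LaurentTortoraDeFalco2006, Def. 13] -/
theorem act_predPoint (t k : ℕ) (xs : List Point) (y : Point) :
    act t k (predPoint xs y) = predPoint (xs.map (act t k)) (act t k y) := by
  cases xs with
  | nil => rfl
  | cons x xs => rw [predPoint_cons, List.map_cons, predPoint_cons, act_par, act_foldl_par]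

/-- The output label is determined by the result of a predicate net. [cite: LaurentTortoraDeFalco2006, Def. 12] -/
theorem predPoint_inj_right {xs : List Point} {y y' : Point} (hk : xs ≠ [])
    (h : predPoint xs y = predPoint xs y') : y = y' := by
  cases xs with
  | nil => exact (hk rfl).elim
  | cons x xs => simpa [predPoint_cons] using h

end Point

/-! ### The data types as cliques -/

/-- `boolClique b`: the interpretation `⟦tt⟧` (`b = true`, identity) / `⟦ff⟧` (`b = false`, twist)
of the nets of the two cut-free proofs of the Boolean type `B = ∀X X⊥ ⅋ X⊥ ⅋ (X ⊗ X)` of §2.1,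
i.e. the set of results of all their experiments (axiom labels range over all of `D`: nets are
untyped). [cite: LaurentTortoraDeFalco2006, §2.1 and Def. 12] -/
def boolClique : Bool → Set Point
  | true => {x | ∃ a b : Point, x = Point.ttPoint a b}
  | false => {x | ∃ a b : Point, x = Point.ffPoint a b}

/-- Membership in `⟦tt⟧` (definitional unfolding). [cite: LaurentTortoraDeFalco2006, Def. 12] -/
@[simp] theorem mem_boolClique_true {x : Point} :
    x ∈ boolClique true ↔ ∃ a b : Point, x = Point.ttPoint a b := Iff.rfl

/-- Membership in `⟦ff⟧` (definitional unfolding). [cite: LaurentTortoraDeFalco2006, Def. 12] -/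
@[simp] theorem mem_boolClique_false {x : Point} :
    x ∈ boolClique false ↔ ∃ a b : Point, x = Point.ffPoint a b := Iff.rfl

/-- `wordClique w = ⟦w̄⟧`: the interpretation of the net of the canonical cut-free proof of
`W = ∀X ?(B ⊗ X ⊗ X⊥) ⅋ X⊥ ⅋ X` coding the binary word `w = w₀ … wₙ₋₁` (§2.1; the list of
Booleans `λc z. c w₀ (c w₁ (… (c wₙ₋₁ z)))`), i.e. the set of results of all its experiments.
[cite: LaurentTortoraDeFalco2006, §2.1 and Def. 12] -/
def wordClique (w : List Bool) : Set Point :=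
  {x | ∃ (β : Fin w.length → Point) (p : Fin (w.length + 1) → Point),
    (∀ i, β i ∈ boolClique w[i]) ∧ x = Point.wordPoint w.length β p}

/-! ### Composition along cuts -/

/-- **Application of a predicate net to an argument** (§2.1, App. B, with the cut clause of
Def. 12): `c` interprets a net with conclusions `W⊥ (k times), B`, `A` a net of conclusion `W`;
cutting the `k` inputs against `k` copies of `A` (each copy with its own experiments), the two
premisses of every cut carry dual labels, so the results on the remaining conclusion `B` are the
`y` with `predPoint [x₁,…,x_k] y ∈ c` and `x̄ᵢ ∈ A` for all `i`. [cite: LaurentTortoraDeFalco2006, Def. 12] -/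
def feed (k : ℕ) (c A : Set Point) : Set Point :=
  {y | ∃ xs : Fin k → Point, Point.predPoint (List.ofFn xs) y ∈ c ∧ ∀ i, Point.dual (xs i) ∈ A}

/-- Membership in `feed k c A` (definitional unfolding). [cite: LaurentTortoraDeFalco2006, Def. 12] -/
@[simp] theorem mem_feed {k : ℕ} {c A : Set Point} {y : Point} : y ∈ feed k c A ↔
    ∃ xs : Fin k → Point, Point.predPoint (List.ofFn xs) y ∈ c ∧ ∀ i, Point.dual (xs i) ∈ A :=
  Iff.rfl

/-- One input: `y ∈ feed 1 c A ↔ ∃ x, x ⅋ y ∈ c ∧ x̄ ∈ A`. [cite: LaurentTortoraDeFalco2006, Def. 12] -/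
theorem mem_feed_one {c A : Set Point} {y : Point} :
    y ∈ feed 1 c A ↔ ∃ x, Point.par x y ∈ c ∧ Point.dual x ∈ A := by
  constructor
  · rintro ⟨xs, h, h'⟩
    exact ⟨xs 0, by simpa [List.ofFn_succ] using h, h' 0⟩
  · rintro ⟨x, h, h'⟩
    exact ⟨fun _ => x, by simpa [List.ofFn_succ] using h, fun _ => h'⟩

/-- No input (a closed net of conclusion `B`): `feed 0 c A = c`. [cite: LaurentTortoraDeFalco2006, Def. 12] -/
@[simp] theorem feed_zero (c A : Set Point) : feed 0 c A = c := by
  ext y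
  simp

/-- `feed` is monotone in both cliques. [cite: LaurentTortoraDeFalco2006, Def. 12] -/
theorem feed_mono {k : ℕ} {c c' A A' : Set Point} (hc : c ⊆ c') (hA : A ⊆ A') :
    feed k c A ⊆ feed k c' A' :=
  fun _ ⟨xs, hx, hx'⟩ => ⟨xs, hc hx, fun i => hA (hx' i)⟩

/-- **Relational composition** of a clique `c` of type `A⊥ ⅋ B` (points `x ⅋ y`) with a clique `d`
of type `B⊥ ⅋ C` (points `y' ⅋ z`) along a cut on `B` (`y' = ȳ`): the points `x ⅋ z` with
`x ⅋ y ∈ c` and `ȳ ⅋ z ∈ d` for some `y` — composition of morphisms of `REL`/`ℕREL` (Def. 2) read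
through the cut clause of Def. 12. [cite: LaurentTortoraDeFalco2006, Def. 2] -/
def compose (c d : Set Point) : Set Point :=
  {w | ∃ x y z, w = Point.par x z ∧ Point.par x y ∈ c ∧ Point.par (Point.dual y) z ∈ d}

/-- Membership in `compose c d` (definitional unfolding). [cite: LaurentTortoraDeFalco2006, Def. 2] -/
@[simp] theorem mem_compose {c d : Set Point} {w : Point} : w ∈ compose c d ↔
    ∃ x y z, w = Point.par x z ∧ Point.par x y ∈ c ∧ Point.par (Point.dual y) z ∈ d := Iff.rfl

/-- **Obsessional cliques compose** (the untyped shadow of Prop. 1, `OREL` is a category): the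
composite along a cut of two `t`-obsessional cliques is `t`-obsessional, because the action is
homomorphic on `⅋` and commutes with duality. [cite: LaurentTortoraDeFalco2006, Prop. 1] -/
theorem IsObsessional.compose {t : ℕ} {c d : Set Point} (hc : IsObsessional t c)
    (hd : IsObsessional t d) : IsObsessional t (compose c d) := by
  rintro _ ⟨x, y, z, rfl, hxy, hyz⟩ k hk
  refine ⟨x.act t k, y.act t k, z.act t k, Point.act_par t k x z, ?_, ?_⟩
  · simpa using hc hxy hk
  · simpa [Point.dual_act] using hd hyz hk

/-- Cliques obsessional from `t` compose. [cite: LaurentTortoraDeFalco2006, Prop. 1] -/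
theorem ObsessionalFrom.compose {t : ℕ} {c d : Set Point} (hc : ObsessionalFrom t c)
    (hd : ObsessionalFrom t d) : ObsessionalFrom t (compose c d) :=
  fun _ hu => (hc hu).compose (hd hu)

/-- Applying a `t`-obsessional predicate clique to a `t`-obsessional argument gives a
`t`-obsessional clique. [cite: LaurentTortoraDeFalco2006, Prop. 1] -/
theorem IsObsessional.feed {t k : ℕ} {c A : Set Point} (hc : IsObsessional t c)
    (hA : IsObsessional t A) : IsObsessional t (feed k c A) := by
  rintro y ⟨xs, hxy, hx⟩ n hn
  refine ⟨fun i => (xs i).act t n, ?_, fun i => ?_⟩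
  · have := hc hxy hn
    rwa [Point.act_predPoint, List.map_ofFn] at this
  · simpa [Point.dual_act] using hA (hx i) hn

/-- `ObsessionalFrom` version of `IsObsessional.feed`. [cite: LaurentTortoraDeFalco2006, Prop. 1] -/
theorem ObsessionalFrom.feed {t k : ℕ} {c A : Set Point} (hc : ObsessionalFrom t c)
    (hA : ObsessionalFrom t A) : ObsessionalFrom t (feed k c A) :=
  fun _ hu => (hc hu).feed (hA hu)

/-! ### Deciding a language at the interface -/

/-- **`CliqueDecides k c L`**: the clique `c ⊆ D`, of the type of a predicate `⊢ W⊥, …, W⊥, B`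
with `k` input copies, decides the language `L ⊆ {0,1}*` at the word→boolean interface: for
every binary word `w`, applying `c` to `k` copies of `⟦w̄⟧` yields exactly `⟦tt⟧` if `w ∈ L` and
exactly `⟦ff⟧` if `w ∉ L` (total and consistent).  By LTdF Thm 3 (invariance of the
interpretation under cut elimination) `⟦R⟧` decides `L` whenever the predicate net `R`
represents `L`.  Interface notion of the route PneNP/LightLogic assembled from §2.1/App. B
(shape of predicates) and Def. 12 (cut clause); not a definition printed in LTdF. [folklore] -/
def CliqueDecides (k : ℕ) (c : Set Point) (L : Language Bool) : Prop :=
  ∀ w : List Bool, (w ∈ L → feed k c (wordClique w) = boolClique true) ∧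
    (w ∉ L → feed k c (wordClique w) = boolClique false)

/-- `⟦tt⟧` and `⟦ff⟧` are nonempty. [cite: LaurentTortoraDeFalco2006, Def. 12] -/
theorem boolClique_nonempty (b : Bool) : (boolClique b).Nonempty := by
  cases b
  · exact ⟨_, Point.one, Point.one, rfl⟩
  · exact ⟨_, Point.one, Point.one, rfl⟩

/-- The generic points of `⟦w̄⟧`. [cite: LaurentTortoraDeFalco2006, Def. 12] -/
theorem wordPoint_mem_wordClique (w : List Bool) {β : Fin w.length → Point}
    (hβ : ∀ i, β i ∈ boolClique w[i]) (p : Fin (w.length + 1) → Point) :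
    Point.wordPoint w.length β p ∈ wordClique w := ⟨β, p, hβ, rfl⟩

/-- `⟦w̄⟧` is nonempty (cut-free nets have experiments, LTdF Remark 2). [cite: LaurentTortoraDeFalco2006, Remark 2] -/
theorem wordClique_nonempty (w : List Bool) : (wordClique w).Nonempty := by
  choose β hβ using fun i : Fin w.length => boolClique_nonempty w[i]
  exact ⟨_, wordPoint_mem_wordClique w hβ fun _ => Point.one⟩

/-- `⟦tt⟧ ≠ ⟦ff⟧`: the point `(1 ⅋ ⊥) ⅋ (⊥ ⊗ 1)` (labels `a = 1`, `b = ⊥`) of `⟦tt⟧` is not in `⟦ff⟧`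
(the two cliques do meet: at `a = b`). [folklore] -/
theorem ttPoint_one_bot_not_mem : Point.ttPoint Point.one Point.bot ∉ boolClique false := by
  rintro ⟨a, b, h⟩
  simp only [Point.ttPoint, Point.ffPoint, Point.par_inj, Point.tensor_inj, Point.dual_one,
    Point.dual_bot] at h
  obtain ⟨⟨rfl, rfl⟩, h2, -⟩ := h
  exact Point.bot_ne_one (h2.trans Point.dual_bot)

/-- `⟦tt⟧ ≠ ⟦ff⟧`. [folklore] -/
theorem boolClique_true_ne_false : boolClique true ≠ boolClique false := by
  intro h
  have : Point.ttPoint Point.one Point.bot ∈ boolClique true := ⟨_, _, rfl⟩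
  rw [h] at this
  exact ttPoint_one_bot_not_mem this

/-- `boolClique` is injective. [folklore] -/
theorem boolClique_injective : Function.Injective boolClique := by
  intro b b' h
  cases b <;> cases b'
  · rfl
  · exact (boolClique_true_ne_false h.symm).elim
  · exact (boolClique_true_ne_false h).elim
  · rfl

/-- A clique decides at most one language. [folklore] -/
theorem CliqueDecides.unique {k : ℕ} {c : Set Point} {L L' : Language Bool}
    (h : CliqueDecides k c L) (h' : CliqueDecides k c L') : L = L' := by
  ext w
  by_contra hw
  rcases not_iff.1 hw |>.symm |> iff_iff_and_or_not_and_not.1 with ⟨h1, h2⟩ | ⟨h1, h2⟩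
  · exact boolClique_true_ne_false (((h' w).1 h1).symm.trans ((h w).2 h2))
  · exact boolClique_true_ne_false (((h w).1 (not_not.1 h2)).symm.trans ((h' w).2 h1))

/-- The language decided by a deciding clique, read off the interface. [folklore] -/
theorem CliqueDecides.mem_iff {k : ℕ} {c : Set Point} {L : Language Bool}
    (h : CliqueDecides k c L) (w : List Bool) :
    w ∈ L ↔ feed k c (wordClique w) = boolClique true := by
  refine ⟨(h w).1, fun hw => by_contra fun hn => ?_⟩
  exact boolClique_true_ne_false (hw.symm.trans ((h w).2 hn))

end Literature.Computability.ImplicitComplexity.URel
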